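import Mathlib
import Summits.Schanuel.Schanuel.Theses.RigidCore
import Literature.NumberTheory.Transcendental.PeriodsWave0
import Literature.NumberTheory.Transcendental.GelfondExpLogConjectureProofs
import Literature.Barriers.Schanuel.LargeTranscendenceDegree
import Literature.Barriers.Schanuel.LargeTranscendenceDegreeTwoTwoProofs
import Literature.Barriers.Schanuel.LargeTranscendenceDegreeSmallTrdegProofs
import Literature.Barriers.Schanuel.AlgebraicIndependenceOfLogarithms
import Literature.Barriers.Schanuel.NesterenkoModularScope

/-!
# Strategy-census artefact (crux-strategist, crux `stmt-Schanuel-0970` = `RigidCore.SchanuelOnLogFreeCore`)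

## The Brownawell–Waldschmidt bridge between the two residues of (R)

Every checked line on the crux (R) ends in a residue containing, at its FIRST instances,
* `e ⊥ π` — the instance `x = (1, πi)` of (R) (stub A of line `generic-period-fibre`,
  `stub_relLWZero` at `u = (1)` of line `kernel-tower-relative-lw`;
  `Literature.NumberTheory.Transcendental.ExpOnePiAlgebraicIndependent`, printed OPEN), and
* `e^{π²} ∉ ℚ̄` — the instance `x = (πi, π²)` (stub B, resp. `stub_relLWZero` at `u = (π²)`;
  printed OPEN, Waldschmidt 2000 §1.4).

This file records, kernel-checked, that the two cannot BOTH fail: the Brownawell–Waldschmidt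
theorem (Baker, *TNT* Thm 12.2 = Nesterenko–Philippon LNM 1752 Ch. 14 Thm 2.9 "Moreover";
PROVED in the tree as `Literature.Barriers.Schanuel.smallTrdeg_thm_2_9_two_two_holds`) at
`x = y = (πi, 1)` — algebraic exponentials `e^{(πi)²} = e^{−π²}` (if `e^{π²} ∈ ℚ̄`) and
`e^{πi} = −1` — gives `trdeg ℚ(πi, 1, e^{−π²}, −1, e) ≥ 2`, i.e. `e ⊥ π`.

So: `Transcendental ℚ e^{π²} ∨ (e ⊥ π)` unconditionally — the classical corollary of
Brownawell 1974 / Waldschmidt 1973, here in the crux's coordinates: at least one of the two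
first open cells of (R) is TRUE.  It is NOT a line (it proves no cell), and it is the exact reach
of the `d = ℓ = 2` Gel'fond–Schneider method on the kernel data `(πi, 1)`: the method needs two
ALGEBRAIC exponentials in one row, and the kernel supplies exactly one (`e^{πi} = −1`) for free.
-/

noncomputable section

open Complex IntermediateField
open Literature.Barriers.Schanuel
open Literature.NumberTheory.Transcendental

namespace Summit.Schanuel.Schanuel.Cruxes.SchanuelOnLogFreeCore.Census

/-- **Brownawell–Waldschmidt on the kernel row `(πi, 1)`**: either `e^{π²}` is transcendental or
`e` and `π` are algebraically independent. [cite: BakerTNT1975, Ch. 12 Theorem 12.2]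
[cite: NesterenkoPhilippon2001, Ch. 14 Theorem 2.9 (Moreover clause)] -/
theorem transcendental_exp_pi_sq_or_expOnePiAlgebraicIndependent :
    Transcendental ℚ (cexp ((Real.pi : ℂ) ^ 2)) ∨ ExpOnePiAlgebraicIndependent := by
  by_contra hnot
  rw [not_or, Transcendental, not_not] at hnot
  obtain ⟨h1, h2⟩ := hnot
  apply h2
  -- the kernel row
  set t : ℂ := (Real.pi : ℂ) * I with ht
  have htt : Transcendental ℚ t := transcendental_pi_mul_I
  obtain ⟨hx, -⟩ := linearIndependent_pair_of_transcendental htt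
  have htt2 : t * t = -((Real.pi : ℂ) ^ 2) := by
    rw [ht]; ring_nf; rw [Complex.I_sq]; ring
  have hexp00 : IsAlgebraic ℚ (cexp (t * t)) := by
    rw [htt2, Complex.exp_neg]
    exact h1.inv
  have hexp_t : cexp t = -1 := by rw [ht, Complex.exp_pi_mul_I]
  have hexp01 : IsAlgebraic ℚ (cexp (t * 1)) := by
    rw [mul_one, hexp_t]; exact isAlgebraic_one.neg
  have h2le := smallTrdeg_thm_2_9_two_two_holds ![t, 1] ![t, 1] hx hx
    (by simpa using hexp00) (by simpa using hexp01)
  -- every generator of `ℚ(x, y, e^{xᵢyⱼ})` is in `ℚ(e, π)(i, e^{-π²})`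
  set l : Fin 2 → ℂ := fun i => ((![Real.exp 1, Real.pi] i : ℝ) : ℂ) with hldef
  set T : Set ℂ := {Complex.I, cexp (t * t)} with hT
  have hTalg : ∀ z ∈ T, IsAlgebraic ℚ z := by
    rintro z (rfl | rfl)
    · exact isAlgebraic_I
    · exact hexp00
  have he : cexp 1 ∈ adjoin ℚ (Set.range l ∪ T) := by
    refine subset_adjoin ℚ _ (Or.inl ⟨0, ?_⟩)
    simp [hldef, Complex.ofReal_exp]
  have hpi : (Real.pi : ℂ) ∈ adjoin ℚ (Set.range l ∪ T) :=
    subset_adjoin ℚ _ (Or.inl ⟨1, by simp [hldef]⟩)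
  have hI : Complex.I ∈ adjoin ℚ (Set.range l ∪ T) := subset_adjoin ℚ _ (Or.inr (Or.inl rfl))
  have htmem : t ∈ adjoin ℚ (Set.range l ∪ T) := by rw [ht]; exact mul_mem hpi hI
  have hett : cexp (t * t) ∈ adjoin ℚ (Set.range l ∪ T) := subset_adjoin ℚ _ (Or.inr (Or.inr rfl))
  have hle : gridField₂ ![t, 1] ![t, 1] ≤ adjoin ℚ (Set.range l ∪ T) := by
    rw [gridField₂, adjoin_le_iff]
    rintro z ((⟨i, rfl⟩ | ⟨j, rfl⟩) | ⟨p, rfl⟩)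
    · fin_cases i
      · simpa using htmem
      · simp
    · fin_cases j
      · simpa using htmem
      · simp
    · obtain ⟨i, j⟩ := p
      fin_cases i <;> fin_cases j
      · simpa using hett
      · simp [hexp_t]
      · simp [hexp_t]
      · simpa using he
  have h2' : (2 : Cardinal) ≤ Algebra.trdeg ℚ (adjoin ℚ (Set.range l)) := by
    refine (h2le.trans (trdeg_mono hle)).trans_eq ?_
    exact trdeg_adjoin_union_eq_of_isAlgebraic _ _ hTalg
  have h2'' : ((2 : ℕ) : Cardinal) ≤ Algebra.trdeg ℚ (adjoin ℚ (Set.range l)) := by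
    simpa using h2'
  exact algebraicIndependent_real_of_complex _ (algebraicIndependent_of_le_trdeg_adjoin l h2'')

/-- The same, as an implication between the two residues' first instances: if stub B fails at its
first instance (`e^{π²}` algebraic) then stub A holds at its first instance (`e ⊥ π`). [folklore] -/
theorem expOnePiAlgebraicIndependent_of_isAlgebraic_exp_pi_sq
    (h : IsAlgebraic ℚ (cexp ((Real.pi : ℂ) ^ 2))) : ExpOnePiAlgebraicIndependent :=
  transcendental_exp_pi_sq_or_expOnePiAlgebraicIndependent.resolve_left (fun ht => ht h)

end Summit.Schanuel.Schanuel.Cruxes.SchanuelOnLogFreeCore.Census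

end
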